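import Summits.Ventures.YMGap.Thresholds.RegionPoincare
import Summits.Ventures.YMGap.Thresholds.ExpWordCalculus
import Literature.MathematicalPhysics.QuantumFieldTheory.LatticeGaugeDobrushin
import HarnessLib

/-!
# Venture YMGap — track (a), OBJECT U1, part 1/2: plaquette words of the DLR-KERNEL potential
# (frozen exterior) and the cross-link interaction matrix `h_E(e,e') = N|β|·k_E(e,e')` — DEFINITIONS

HONEST FRAMING: venture file (cell `pub-ymgap`, track (a), seat ds-2; brick U1 for the OBJECT U line:
hypothesis-free DLR uniqueness at `|β| < 1/(8d)` via the static covariance bound for the region kernels).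
Pure finite-dimensional calculus + `ℤ^d` lattice counting; NO measure, NO threshold, NO uniqueness or
clustering statement. Nothing about the continuum or the mass gap.

p2's kernel potential on `(E → M_N(ℂ))` (`RegionPoincare.regionPot E η β`, 't Hooft coupling `β`,
tree coupling `Nβ`) is `Nβ Σ_{p ∈ plaquettesTouching E} Re tr(w₀ w₁ w₂ᴴ w₃ᴴ)` with
`w_k = linkOrExt E η Q (zSlot p k)`: the interior variable `Q_e` on `E`, the frozen exterior matrix
`η_e` off `E`. This file is the region analogue of `SharpClusteringWilsonWords.lean`:

* `zSlot p : Fin 4 → ZdEdge d` — the four (pairwise distinct, `zSlot_injective`) links of a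
  `ℤ^d` plaquette in the order of `plaquetteEdges` / `regionPot₀`;
* `extDir E A e = A_e` on `E`, `0` off `E` — the direction read by the link `e` under the flow
  `Q ↦ Q e^{tA}` (frozen links do not move: `linkOrExt_mul_exp`);
* `regWord E η p c₁ c₂ c₃ (Q) = Re tr(w₀ c₁ w₁ c₂ w₂ᴴ c₃ w₃ᴴ)` — the kernel plaquette word with constant
  insertions; `regionPot₀ E η = Σ_p regWord E η p 1 1 1` (`regionPot₀_eq_sum_regWord`); polynomial,
  smooth; CLOSED UNDER LEFT-INVARIANT DIFFERENTIATION (`algD_regWord`, from p2's `hasDerivAt_reTrWord`):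
  `D_A W(c₁,c₂,c₃) = W(A₀c₁,c₂,c₃) + W(c₁,A₁c₂,c₃) + W(c₁,c₂A₂ᴴ,c₃) + W(c₁,c₂,c₃A₃ᴴ)`, `A_k = extDir E A (zSlot p k)`;
* `zJoint E x y = #{p ∈ plaquettesTouching E : x, y ∈ plaquetteEdges p}` and the CROSS-LINK INTERACTION
  MATRIX `regionH N E β e e' = N|β| · zJoint E e e'` for `e ≠ e'` in `E`, `0` on the diagonal
  (Shen–Zhu–Zhu (4.3) for the kernel potential): nonnegative, symmetric, of finite range
  (`supNorm_le_one_of_regionH_ne_zero`: base points at sup-distance `≤ 1`, the tree's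
  `norm_sub_le_one_of_mem_plaquetteEdges`) and with ROW SUMS `≤ 6(d-1)N|β|` UNIFORMLY in `E`
  (`sum_regionH_le`: `≤ 2(d-1)` plaquettes through a link, `≤ 3` other links each — the tree's
  `card_plaquettesTouching_singleton_le`, `card_plaquetteEdges_le`).

These are four of the five binders of lit-1's `kernel_covariance_exp_decay` (OBJECT U2, (T_E)); the
fifth, `OffDiagHessBound (regionPot E η β) (regionH N E β)`, is part 2/2 (`SharpClusteringRegionOffDiag`).

References: H. Shen, R. Zhu, X. Zhu, CMP 400 (2023) 805–851, Lemma 4.1, (4.3), Remark 1.3 (boundary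
conditions); E. Seiler, LNP 159 (1982) Ch. 2.
-/

noncomputable section

open scoped Matrix ComplexConjugate BigOperators Matrix.Norms.Frobenius ContDiff Topology
open Matrix Complex Finset
open Literature.MathematicalPhysics.QuantumFieldTheory hiding ZdEdge
open Literature.MathematicalPhysics.QuantumLattice (LGConfig ZdEdge ZdPlaquette plaquetteEdges plaquettesTouching
  mem_plaquettesTouching_iff)
open Literature.MathematicalPhysics.QuantumFieldTheory.SUNBakryEmery (SUN)
open Summit.Ventures.YMGap.HessianSharp (expWord reTrWord reTrWord_zero hasDerivAt_reTrWord)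

namespace Summit.Ventures.YMGap

namespace SharpClustering

open LatticeBakryEmery

variable {d N : ℕ}

/-! ### The four links of a `ℤ^d` plaquette -/

/-- The four links of the plaquette `p = (x; i<j)` of `ℤ^d`, in the order of `plaquetteEdges` and of
p2's `regionPot₀`: `(x,i)`, `(x+eᵢ,j)`, `(x+eⱼ,i)`, `(x,j)`. -/
def zSlot (p : ZdPlaquette d) : Fin 4 → ZdEdge d :=
  ![(p.1, p.2.1.1), (p.1 + Pi.single p.2.1.1 1, p.2.1.2), (p.1 + Pi.single p.2.1.2 1, p.2.1.1), (p.1, p.2.1.2)]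

/-- Slot `0`. -/
@[simp] theorem zSlot_zero (p : ZdPlaquette d) : zSlot p 0 = (p.1, p.2.1.1) := rfl
/-- Slot `1`. -/
@[simp] theorem zSlot_one (p : ZdPlaquette d) : zSlot p 1 = (p.1 + Pi.single p.2.1.1 1, p.2.1.2) := rfl
/-- Slot `2`. -/
@[simp] theorem zSlot_two (p : ZdPlaquette d) : zSlot p 2 = (p.1 + Pi.single p.2.1.2 1, p.2.1.1) := rfl
/-- Slot `3`. -/
@[simp] theorem zSlot_three (p : ZdPlaquette d) : zSlot p 3 = (p.1, p.2.1.2) := rfl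

/-- The edge set of a plaquette is the set of its four slots. -/
theorem mem_plaquetteEdges_iff_exists_zSlot {p : ZdPlaquette d} {e : ZdEdge d} :
    e ∈ plaquetteEdges p ↔ ∃ j, zSlot p j = e := by
  constructor
  · intro h
    simp only [plaquetteEdges, mem_insert, mem_singleton] at h
    rcases h with h | h | h | h
    · exact ⟨0, by rw [h]; rfl⟩
    · exact ⟨1, by rw [h]; rfl⟩
    · exact ⟨2, by rw [h]; rfl⟩
    · exact ⟨3, by rw [h]; rfl⟩
  · rintro ⟨j, rfl⟩
    fin_cases j <;> simp [plaquetteEdges, zSlot]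

/-- In `ℤ^d` the four slots of a plaquette are pairwise distinct links. -/
theorem zSlot_injective (p : ZdPlaquette d) : Function.Injective (zSlot p) := by
  have hij : p.2.1.1 ≠ p.2.1.2 := p.2.2.ne
  have hshift : ∀ i : Fin d, p.1 + Pi.single i 1 ≠ p.1 := fun i h => by
    have := congr_fun h i
    simp at this
  have h01 : zSlot p 0 ≠ zSlot p 1 := fun h => hij (congrArg Prod.snd h)
  have h03 : zSlot p 0 ≠ zSlot p 3 := fun h => hij (congrArg Prod.snd h)
  have h12 : zSlot p 1 ≠ zSlot p 2 := fun h => hij (congrArg Prod.snd h).symm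
  have h23 : zSlot p 2 ≠ zSlot p 3 := fun h => hij (congrArg Prod.snd h)
  have h02 : zSlot p 0 ≠ zSlot p 2 := fun h => hshift _ (congrArg Prod.fst h).symm
  have h13 : zSlot p 1 ≠ zSlot p 3 := fun h => hshift _ (congrArg Prod.fst h)
  intro a b hab
  fin_cases a <;> fin_cases b
  all_goals first
    | rfl
    | exact absurd hab h01 | exact absurd hab.symm h01 | exact absurd hab h02 | exact absurd hab.symm h02
    | exact absurd hab h03 | exact absurd hab.symm h03 | exact absurd hab h12 | exact absurd hab.symm h12
    | exact absurd hab h13 | exact absurd hab.symm h13 | exact absurd hab h23 | exact absurd hab.symm h23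

/-! ### Directions read by a link; the kernel plaquette word with constant insertions -/

/-- The direction read by the link `e` under the flow `Q ↦ Q e^{tA}`: `A_e` on `E`, `0` off `E`
(frozen links do not move). -/
def extDir (E : Finset (ZdEdge d)) (A : Cfg ↥E N) (e : ZdEdge d) : Matrix (Fin N) (Fin N) ℂ :=
  if h : e ∈ E then A ⟨e, h⟩ else 0

/-- The **kernel plaquette word with constant insertions**
`W_{E,η,p}(c₁,c₂,c₃)(Q) = Re tr(w₀ c₁ w₁ c₂ w₂ᴴ c₃ w₃ᴴ)`, `w_k = linkOrExt E η Q (zSlot p k)`. -/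
def regWord (E : Finset (ZdEdge d)) (η : LGConfig d (SUN N)) (p : ZdPlaquette d)
    (c₁ c₂ c₃ : Matrix (Fin N) (Fin N) ℂ) : Cfg ↥E N → ℝ := fun Q =>
  (linkOrExt E η Q (zSlot p 0) * c₁ * linkOrExt E η Q (zSlot p 1) * c₂ * (linkOrExt E η Q (zSlot p 2))ᴴ * c₃ *
    (linkOrExt E η Q (zSlot p 3))ᴴ).trace.re

/-- `regionPot₀ E η = Σ_{p ∈ plaquettesTouching E} W_{E,η,p}(1,1,1)`. -/
theorem regionPot₀_eq_sum_regWord (E : Finset (ZdEdge d)) (η : LGConfig d (SUN N)) :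
    regionPot₀ (N := N) E η = fun Q => ∑ p ∈ plaquettesTouching E, regWord E η p 1 1 1 Q := by
  funext Q
  simp only [regionPot₀, regWord, zSlot_zero, zSlot_one, zSlot_two, zSlot_three, Matrix.mul_one]

/-- The kernel plaquette word is a polynomial of degree `≤ 4` in the interior coordinates. -/
theorem regWord_mem_polySpace (E : Finset (ZdEdge d)) (η : LGConfig d (SUN N)) (p : ZdPlaquette d)
    (c₁ c₂ c₃ : Matrix (Fin N) (Fin N) ℂ) : regWord (N := N) E η p c₁ c₂ c₃ ∈ polySpace ↥E N 4 := by
  have h : IsCPolyMat (ι := ↥E) (N := N) (1 + 0 + 1 + 0 + 1 + 0 + 1) fun Q =>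
      linkOrExt E η Q (zSlot p 0) * c₁ * linkOrExt E η Q (zSlot p 1) * c₂ * (linkOrExt E η Q (zSlot p 2))ᴴ * c₃ *
        (linkOrExt E η Q (zSlot p 3))ᴴ :=
    ((((((isCPolyMat_linkOrExt E η _).mul (isCPolyMat_const c₁)).mul (isCPolyMat_linkOrExt E η _)).mul
      (isCPolyMat_const c₂)).mul (isCPolyMat_linkOrExt E η _).conjTranspose).mul (isCPolyMat_const c₃)).mul
      (isCPolyMat_linkOrExt E η _).conjTranspose
  exact h.re_trace_mem

/-- The kernel plaquette word is smooth. -/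
theorem contDiff_regWord (E : Finset (ZdEdge d)) (η : LGConfig d (SUN N)) (p : ZdPlaquette d)
    (c₁ c₂ c₃ : Matrix (Fin N) (Fin N) ℂ) : ContDiff ℝ ∞ (regWord (N := N) E η p c₁ c₂ c₃) :=
  contDiff_of_mem_polySpace (regWord_mem_polySpace E η p c₁ c₂ c₃)

/-- **Frozen links do not move**: along the flow `Q ↦ Q e^{tA}`,
`linkOrExt E η (Q e^{tA}) e = linkOrExt E η Q e · e^{t · extDir E A e}`. -/
theorem linkOrExt_mul_exp (E : Finset (ZdEdge d)) (η : LGConfig d (SUN N)) (Q A : Cfg ↥E N) (t : ℝ)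
    (e : ZdEdge d) :
    linkOrExt E η (Q * NormedSpace.exp (t • A)) e = linkOrExt E η Q e * NormedSpace.exp (t • extDir E A e) := by
  by_cases h : e ∈ E
  · simp only [linkOrExt, extDir, dif_pos h, Pi.mul_apply,
      show NormedSpace.exp (t • A) = fun e => NormedSpace.exp ((t • A) e) from Pi.exp_def _]
    rfl
  · simp only [linkOrExt, extDir, dif_neg h, smul_zero, NormedSpace.exp_zero, Matrix.mul_one]

/-- Along the flow `t ↦ Q e^{tA}` the kernel plaquette word is p2's `reTrWord` with
`B₀ = w₀, V₁ = A₀, B₁ = c₁w₁, V₂ = A₁, B₂ = c₂, V₃ = A₂ᴴ, B₃ = w₂ᴴc₃, V₄ = A₃ᴴ, B₄ = w₃ᴴ`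
(`w_k = linkOrExt E η Q (zSlot p k)`, `A_k = extDir E A (zSlot p k)`). -/
theorem regWord_mul_exp (E : Finset (ZdEdge d)) (η : LGConfig d (SUN N)) (p : ZdPlaquette d)
    (c₁ c₂ c₃ : Matrix (Fin N) (Fin N) ℂ) (Q A : Cfg ↥E N) (t : ℝ) :
    regWord E η p c₁ c₂ c₃ (Q * NormedSpace.exp (t • A)) =
      reTrWord (linkOrExt E η Q (zSlot p 0)) (extDir E A (zSlot p 0)) (c₁ * linkOrExt E η Q (zSlot p 1))
        (extDir E A (zSlot p 1)) c₂ (extDir E A (zSlot p 2))ᴴ ((linkOrExt E η Q (zSlot p 2))ᴴ * c₃)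
        (extDir E A (zSlot p 3))ᴴ ((linkOrExt E η Q (zSlot p 3))ᴴ) t := by
  have hct : ∀ e : ZdEdge d, (linkOrExt E η Q e * NormedSpace.exp (t • extDir E A e))ᴴ =
      NormedSpace.exp (t • (extDir E A e)ᴴ) * (linkOrExt E η Q e)ᴴ := by
    intro e
    rw [Matrix.conjTranspose_mul, ← Matrix.exp_conjTranspose, Matrix.conjTranspose_smul]
    simp
  simp only [regWord, reTrWord, expWord, linkOrExt_mul_exp, hct, Matrix.mul_assoc]

/-- **The kernel plaquette words are closed under left-invariant differentiation.** -/
theorem algD_regWord (E : Finset (ZdEdge d)) (η : LGConfig d (SUN N)) (p : ZdPlaquette d)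
    (c₁ c₂ c₃ : Matrix (Fin N) (Fin N) ℂ) (A : Cfg ↥E N) :
    algD A (regWord E η p c₁ c₂ c₃) =
      regWord E η p (extDir E A (zSlot p 0) * c₁) c₂ c₃ + regWord E η p c₁ (extDir E A (zSlot p 1) * c₂) c₃ +
        regWord E η p c₁ (c₂ * (extDir E A (zSlot p 2))ᴴ) c₃ +
          regWord E η p c₁ c₂ (c₃ * (extDir E A (zSlot p 3))ᴴ) := by
  funext Q
  have h1 := hasDerivAt_comp_mul_exp (contDiff_regWord (N := N) E η p c₁ c₂ c₃) Q A 0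
  rw [zero_smul, NormedSpace.exp_zero, mul_one] at h1
  have h2 : HasDerivAt
      (reTrWord (linkOrExt E η Q (zSlot p 0)) (extDir E A (zSlot p 0)) (c₁ * linkOrExt E η Q (zSlot p 1))
        (extDir E A (zSlot p 1)) c₂ (extDir E A (zSlot p 2))ᴴ ((linkOrExt E η Q (zSlot p 2))ᴴ * c₃)
        (extDir E A (zSlot p 3))ᴴ ((linkOrExt E η Q (zSlot p 3))ᴴ))
      (algD A (regWord E η p c₁ c₂ c₃) Q) 0 :=
    h1.congr_of_eventuallyEq (Filter.Eventually.of_forall fun s => (regWord_mul_exp E η p c₁ c₂ c₃ Q A s).symm)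
  have h3 := hasDerivAt_reTrWord (linkOrExt E η Q (zSlot p 0)) (extDir E A (zSlot p 0))
    (c₁ * linkOrExt E η Q (zSlot p 1)) (extDir E A (zSlot p 1)) c₂ (extDir E A (zSlot p 2))ᴴ
    ((linkOrExt E η Q (zSlot p 2))ᴴ * c₃) (extDir E A (zSlot p 3))ᴴ ((linkOrExt E η Q (zSlot p 3))ᴴ) 0
  rw [h2.unique h3]
  simp only [Pi.add_apply, reTrWord_zero, regWord, Matrix.mul_assoc]

/-- At a point of `SU(N)^E` every link matrix (interior or frozen) is unitary. -/
theorem linkOrExt_emb_mem_unitaryGroup (E : Finset (ZdEdge d)) (η : LGConfig d (SUN N)) (g : PSU ↥E N)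
    (e : ZdEdge d) : linkOrExt E η (emb g) e ∈ Matrix.unitaryGroup (Fin N) ℂ := by
  by_cases h : e ∈ E
  · simp only [linkOrExt, dif_pos h, emb_apply]
    exact Matrix.specialUnitaryGroup_le_unitaryGroup (g ⟨e, h⟩).2
  · simp only [linkOrExt, dif_neg h]
    exact Matrix.specialUnitaryGroup_le_unitaryGroup (η e).2

/-- The direction read by the slot `e'` in the single-link direction `single_e X`:
`X` if `e' = e`, else `0`. -/
theorem extDir_lk (E : Finset (ZdEdge d)) (e : ↥E) (X : Matrix (Fin N) (Fin N) ℂ) (e' : ZdEdge d) :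
    extDir E (lk (ι := ↥E) e X) e' = if e' = (e : ZdEdge d) then X else 0 := by
  unfold extDir lk
  by_cases h : e' = (e : ZdEdge d)
  · subst h
    rw [dif_pos e.2, if_pos rfl]
    simp
  · rw [if_neg h]
    by_cases h' : e' ∈ E
    · rw [dif_pos h', Pi.single_apply, if_neg]
      intro hc
      exact h (congrArg Subtype.val hc)
    · rw [dif_neg h']

/-! ### Lattice bookkeeping on `ℤ^d`: joint plaquettes and the cross-link matrix -/

/-- The number of slots of `p` carrying the link `e` (`0` or `1`: `slotCount_eq_ite`). -/
def slotCount (p : ZdPlaquette d) (e : ZdEdge d) : ℕ := (univ.filter fun j : Fin 4 => zSlot p j = e).card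

/-- `slotCount p e = [e ∈ plaquetteEdges p]`. -/
theorem slotCount_eq_ite (p : ZdPlaquette d) (e : ZdEdge d) :
    slotCount p e = if e ∈ plaquetteEdges p then 1 else 0 := by
  classical
  by_cases h : e ∈ plaquetteEdges p
  · rw [if_pos h]
    obtain ⟨j, hj⟩ := mem_plaquetteEdges_iff_exists_zSlot.1 h
    refine Finset.card_eq_one.2 ⟨j, ?_⟩
    ext k
    simp only [mem_filter, mem_univ, true_and, mem_singleton]
    rw [← hj]
    exact (zSlot_injective p).eq_iff
  · rw [if_neg h]
    refine Finset.card_eq_zero.2 (Finset.filter_eq_empty_iff.2 fun k _ hk => h ?_)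
    exact mem_plaquetteEdges_iff_exists_zSlot.2 ⟨k, hk⟩

/-- The **joint-plaquette multiplicity inside the region**: the number of plaquettes touching `E` that
contain both links `x` and `y` (Shen–Zhu–Zhu's `k(x,y)`, restricted to `plaquettesTouching E` —
no restriction at all when `x ∈ E`). -/
def zJoint (E : Finset (ZdEdge d)) (x y : ZdEdge d) : ℕ :=
  ((plaquettesTouching E).filter fun p => x ∈ plaquetteEdges p ∧ y ∈ plaquetteEdges p).card

/-- `k_E(x,y) = k_E(y,x)`. -/
theorem zJoint_comm (E : Finset (ZdEdge d)) (x y : ZdEdge d) : zJoint E x y = zJoint E y x := by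
  unfold zJoint
  congr 1
  exact Finset.filter_congr fun q _ => And.comm

/-- `Σ_{p ∈ plaquettesTouching E} slotCount p x · slotCount p y = k_E(x,y)`. -/
theorem sum_slotCount_mul_eq_zJoint (E : Finset (ZdEdge d)) (x y : ZdEdge d) :
    ∑ p ∈ plaquettesTouching E, slotCount p x * slotCount p y = zJoint E x y := by
  classical
  rw [zJoint, Finset.card_filter]
  refine sum_congr rfl fun p _ => ?_
  rw [slotCount_eq_ite, slotCount_eq_ite]
  by_cases h1 : x ∈ plaquetteEdges p <;> by_cases h2 : y ∈ plaquetteEdges p <;> simp [h1, h2]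

/-- **The cross-link interaction matrix of the kernel potential** at 't Hooft coupling `β`:
`h_E(e,e') = N|β| · k_E(e,e')` for distinct interior links, `0` on the diagonal
(Shen–Zhu–Zhu (4.3) for the frozen-exterior potential). -/
def regionH (N : ℕ) (E : Finset (ZdEdge d)) (β : ℝ) (e e' : ↥E) : ℝ :=
  if e = e' then 0 else (N : ℝ) * |β| * zJoint E e e'

/-- `h_E ≥ 0`. -/
theorem regionH_nonneg (N : ℕ) (E : Finset (ZdEdge d)) (β : ℝ) (e e' : ↥E) : 0 ≤ regionH N E β e e' := by
  unfold regionH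
  split_ifs
  · exact le_rfl
  · positivity

/-- `h_E` is symmetric. -/
theorem regionH_symm (N : ℕ) (E : Finset (ZdEdge d)) (β : ℝ) (e e' : ↥E) :
    regionH N E β e e' = regionH N E β e' e := by
  unfold regionH
  rw [zJoint_comm]
  by_cases h : e = e'
  · subst h; rfl
  · rw [if_neg h, if_neg (Ne.symm h)]

/-- `h_E` vanishes on the diagonal. -/
theorem regionH_self (N : ℕ) (E : Finset (ZdEdge d)) (β : ℝ) (e : ↥E) : regionH N E β e e = 0 := by
  simp [regionH]

/-- **Finite range**: `h_E(e,e') ≠ 0` forces a common plaquette, hence base points at `ℓ^∞`-distance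
`≤ 1` (the tree's `norm_sub_le_one_of_mem_plaquetteEdges`). -/
theorem supNorm_le_one_of_regionH_ne_zero {N : ℕ} {E : Finset (ZdEdge d)} {β : ℝ} {e e' : ↥E}
    (h : regionH N E β e e' ≠ 0) :
    Literature.Probability.LatticeModels.Site.supNorm (e.1.1 - e'.1.1) ≤ 1 := by
  classical
  unfold regionH at h
  by_cases he : e = e'
  · rw [if_pos he] at h; exact absurd rfl h
  rw [if_neg he] at h
  have hk : zJoint E e e' ≠ 0 := fun h0 => h (by rw [h0, Nat.cast_zero, mul_zero])
  obtain ⟨p, hp⟩ := Finset.card_ne_zero.1 hk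
  obtain ⟨-, hx, hy⟩ := Finset.mem_filter.1 hp
  have h1 := norm_sub_le_one_of_mem_plaquetteEdges hx hy
  rw [Literature.Probability.LatticeModels.Site.norm_eq_supNorm] at h1
  exact_mod_cast h1

/-- **Row sums**: `Σ_{e'} h_E(e,e') ≤ 6(d-1) N|β|`, uniformly in the region `E` (each of the
`≤ 2(d-1)` plaquettes through `e` has `≤ 3` other links). -/
theorem sum_regionH_le (N : ℕ) (E : Finset (ZdEdge d)) (β : ℝ) (e : ↥E) :
    ∑ e', regionH N E β e e' ≤ 6 * ((d : ℝ) - 1) * N * |β| := by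
  classical
  -- reduce to a natural-number count
  have hcount : ∑ e' ∈ univ.filter (fun e' : ↥E => e' ≠ e), zJoint E e e' ≤ 6 * (d - 1) := by
    have hthree : ∀ p ∈ (plaquettesTouching E).filter (fun p => (e : ZdEdge d) ∈ plaquetteEdges p),
        ((univ.filter fun e' : ↥E => e' ≠ e).filter fun e' : ↥E => (e' : ZdEdge d) ∈ plaquetteEdges p).card ≤ 3 :=
      fun p hp => by
      have hep : (e : ZdEdge d) ∈ plaquetteEdges p := (Finset.mem_filter.1 hp).2
      have hinj : Set.InjOn (fun e' : ↥E => (e' : ZdEdge d))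
          ↑((univ.filter fun e' : ↥E => e' ≠ e).filter fun e' : ↥E => (e' : ZdEdge d) ∈ plaquetteEdges p) :=
        fun a _ b _ hab => Subtype.ext hab
      have hmaps : ∀ e' ∈ (univ.filter fun e' : ↥E => e' ≠ e).filter
          (fun e' : ↥E => (e' : ZdEdge d) ∈ plaquetteEdges p),
          (fun e' : ↥E => (e' : ZdEdge d)) e' ∈ (plaquetteEdges p).erase (e : ZdEdge d) := by
        intro e' he'
        simp only [Finset.mem_filter, Finset.mem_univ, true_and] at he'
        exact Finset.mem_erase.2 ⟨fun hc => he'.1 (Subtype.ext hc), he'.2⟩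
      calc _ ≤ ((plaquetteEdges p).erase (e : ZdEdge d)).card := Finset.card_le_card_of_injOn _ hmaps hinj
        _ ≤ 3 := by
            rw [Finset.card_erase_of_mem hep]
            have := card_plaquetteEdges_le p
            omega
    calc ∑ e' ∈ univ.filter (fun e' : ↥E => e' ≠ e), zJoint E e e'
        = ∑ e' ∈ univ.filter (fun e' : ↥E => e' ≠ e), ∑ p ∈ plaquettesTouching E,
            (if (e : ZdEdge d) ∈ plaquetteEdges p ∧ (e' : ZdEdge d) ∈ plaquetteEdges p then 1 else 0) := by
          refine sum_congr rfl fun e' _ => ?_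
          rw [zJoint, Finset.card_filter]
      _ = ∑ p ∈ plaquettesTouching E, ∑ e' ∈ univ.filter (fun e' : ↥E => e' ≠ e),
            (if (e : ZdEdge d) ∈ plaquetteEdges p ∧ (e' : ZdEdge d) ∈ plaquetteEdges p then 1 else 0) :=
          Finset.sum_comm
      _ = ∑ p ∈ (plaquettesTouching E).filter (fun p => (e : ZdEdge d) ∈ plaquetteEdges p),
            ((univ.filter fun e' : ↥E => e' ≠ e).filter fun e' : ↥E => (e' : ZdEdge d) ∈ plaquetteEdges p).card := by
          rw [Finset.sum_filter]
          refine sum_congr rfl fun p _ => ?_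
          by_cases hep : (e : ZdEdge d) ∈ plaquetteEdges p
          · rw [if_pos hep, Finset.card_filter]
            refine sum_congr rfl fun e' _ => ?_
            simp [hep]
          · rw [if_neg hep]
            exact Finset.sum_eq_zero fun e' _ => by simp [hep]
      _ ≤ ∑ _p ∈ (plaquettesTouching E).filter (fun p => (e : ZdEdge d) ∈ plaquetteEdges p), 3 := sum_le_sum hthree
      _ = 3 * ((plaquettesTouching E).filter (fun p => (e : ZdEdge d) ∈ plaquetteEdges p)).card := by
          rw [sum_const, smul_eq_mul, mul_comm]
      _ ≤ 3 * (plaquettesTouching {(e : ZdEdge d)}).card := by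
          refine Nat.mul_le_mul_left 3 (Finset.card_le_card fun p hp => ?_)
          rw [mem_plaquettesTouching_iff]
          exact ⟨e, Finset.mem_inter.2 ⟨(Finset.mem_filter.1 hp).2, Finset.mem_singleton_self _⟩⟩
      _ ≤ 3 * (2 * (d - 1)) := Nat.mul_le_mul_left 3 (card_plaquettesTouching_singleton_le _)
      _ = 6 * (d - 1) := by ring
  -- real form
  have hsplit : ∑ e', regionH N E β e e' = (N : ℝ) * |β| * ∑ e' ∈ univ.filter (fun e' : ↥E => e' ≠ e),
      (zJoint E e e' : ℝ) := by
    rw [Finset.mul_sum, Finset.sum_filter]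
    refine sum_congr rfl fun e' _ => ?_
    unfold regionH
    by_cases h : e = e'
    · rw [if_pos h, if_neg (fun h' => h' h.symm)]
    · rw [if_neg h, if_pos (fun h' => h h'.symm)]
  rw [hsplit]
  have hd : ((6 * (d - 1 : ℕ) : ℕ) : ℝ) ≤ 6 * ((d : ℝ) - 1) := by
    rcases Nat.eq_zero_or_pos d with hd0 | hd
    · subst hd0; exact e.1.2.elim0
    · push_cast [Nat.cast_sub hd]; exact le_rfl
  have hc : (∑ e' ∈ univ.filter (fun e' : ↥E => e' ≠ e), (zJoint E e e' : ℝ)) ≤ 6 * ((d : ℝ) - 1) := by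
    have : (∑ e' ∈ univ.filter (fun e' : ↥E => e' ≠ e), (zJoint E e e' : ℝ)) =
        ((∑ e' ∈ univ.filter (fun e' : ↥E => e' ≠ e), zJoint E e e' : ℕ) : ℝ) := by push_cast; rfl
    rw [this]
    exact (Nat.cast_le.2 hcount).trans hd
  calc (N : ℝ) * |β| * ∑ e' ∈ univ.filter (fun e' : ↥E => e' ≠ e), (zJoint E e e' : ℝ)
      ≤ (N : ℝ) * |β| * (6 * ((d : ℝ) - 1)) := mul_le_mul_of_nonneg_left hc (by positivity)
    _ = 6 * ((d : ℝ) - 1) * N * |β| := by ring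

end SharpClustering

end Summit.Ventures.YMGap
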